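import Summits.BirchSwinnertonDyer.BirchSwinnertonDyer.Theorems.PrintCf2SplitBadTwoRestrictedSelmerBottomTrueSelmer
import Summits.BirchSwinnertonDyer.BirchSwinnertonDyer.Theorems.PrintCf2SplitBadTwoRestrictedSelmerEigenProjector
import Literature.NumberTheory.EllipticCurves.Greenberg1999.LocalTowerKummerVanishingProofs
import Literature.NumberTheory.EllipticCurves.KummerSelmerStructure
import HarnessLib

/-!
# Crux `PrintCf2.SplitBadTwoRankOneOfFacts` (stmt-BirchSwinnertonDyer-20368), road α, stub S3c — the classical local condition AT A PLACE
# `v ∤ p` IS local triviality: `localKerOver p ⊤ K_v = awayKer ⊤ E[p^∞] v` (Greenberg: «`Im κ_v = 0`, `E(K_v) ⊗ ℚ_p/ℤ_p = 0` for `v ∤ p`»),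
# and the «trivial away from `p`» half of hypothesis (H1) of the bottom value for the CM summand

Cell `bsd-print-cf2`, width seat `bsd-line-cf2-p1-w7` g2, file 5 of the bottom-value lane (p661732, p662108, p662922 `…EigenProjector`,
p663238 `…BottomTrueSelmer`); `--supports stmt-BirchSwinnertonDyer-20368` (helper, Theses-free). HONEST FRAMING: nothing here closes a crux
or a stub; BSD is not proved by any of this; no summit statement is proved by this seat. No definition, no named fact, no `sorry`, no kit.
beyond-print theorem: no.

WHAT. For an elliptic curve `E = W` over a number field `K`, a prime `p` and a finite place `v ∤ p`:
* §1 `exists_sub_smul_mem_primaryComponent_fixedPoints_top` — **`E(K_v) ⊗ ℚ_p/ℤ_p = 0`** in the form «every `K_v`-rational point of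
  `E(K̄_v)` is `p • (K_v-rational)` up to `p`-power torsion» (Greenberg LNM 1716 §2 Prop. 2.1 at the BASE; the tree had it for the local
  `ℤ_p`-tower `E(K_{∞,η})`, `Greenberg1999.exists_sub_smul_mem_primaryComponent_fixedPoints_localSubgroup` — the proof here is THAT proof
  with `H_∞` replaced by `Γ_{K_v}`: Kodaira–Néron over `K_v^{nr}` `exists_nsmul_mem_kernel_of_forall_inertia`, `[p]` invertible on `E₁`
  `exists_pow_nsmul_eq_of_mem_kernel`, Bézout); `exists_sub_pow_smul_fixed` — the `p^N` form.
* §2 **`localKerOver_top_le_awayKer`** — a class of `H¹(Γ_K, E[p^∞])` (`H = ⊤` currency) satisfying the CLASSICAL local condition at `v`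
  (it dies in `H¹(Γ_{K_v}, E(K̄_v))`, `WeierstrassCurve.localKerOver`) is LOCALLY ZERO at `v` (it dies in `H¹(D_v, E[p^∞])`, Greenberg's
  `awayKer`): the cocycle is `τ ↦ τQ − Q` on `Γ_{K_v}` with `p^N Q ∈ E(K_v)`; by §1 `p^N Q = p^N Q₀ + t` with `Q₀ ∈ E(K_v)`, `t` torsion, so
  `Q − Q₀` is a torsion point, hence ALGEBRAIC (`torsionPointsEquiv`), and `τ ↦ τ(Q−Q₀) − (Q−Q₀)` is a coboundary with values in `E[p^∞]`
  on the decomposition group (`pointsMapOfEmb_injective`, `pointsMap_smul`). With the tree's converse (`AcSigned.awayKer_le_localKummerOverOfEmb`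
  + `Kobayashi2003.localKummerOverOfEmb_le_localKerOverOfEmb`): **`localKerOver_top_eq_awayKer`** — AT `v ∤ p` THE CLASSICAL SELMER CONDITION
  OF `Sel_{p^∞}(E/K)` IS «LOCALLY TRIVIAL», the sentence every restricted/fine Selmer file of the tree quotes (Agboola §3 «`H¹_f(F_v, W) = 0` if
  `v ∤ 𝔭`»; Greenberg §2; Coates–Sujatha §3) and which `Agboola2007/RestrictedSelmerGroups.lean` uses to DEFINE `𝔖_𝔮` via `awayKer`.
* §3 the CM summand `M = E[𝔮^∞]` (complementary eigen-subgroups): **`comap_kummer_le_awayKer_of_not_mem`** — the canonical Kummer subgroup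
  `Q_M = ι_*⁻¹(res_⊤(range κ))` of p663238 is locally zero at every finite `w ∤ p` (ι_* is injective on `H¹(⊤ ⊓ D_w, ·)` by the eigen-projector,
  p662922) — the «trivial away from `p`» half of the displayed hypothesis (H1) `Q_M ≤ 𝔖_v(K, M)` of `natCard_restrictedSelmerBase_eq_three_mul_summand`;
  what remains of (H1) is the condition at the infinite places and STRICTNESS AT `v` (the CM input `E(K_v) ⊗_𝒪 D_{v̄} = 0`).

presearch: Greenberg LNM 1716 §2 Prop. 2.1 / §3 Lemma 3.3 proof (held, chunks p0072/p0087) is the source; the tree's tower version is adapted,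
not restated («adapted from Literature/…/Greenberg1999/LocalTowerKummerVanishingProofs.lean»).
References: R. Greenberg, LNM 1716 (1999) §2 Prop. 2.1, §3 Lemma 3.3 [GreenbergLNM1716]; J. H. Silverman, *AEC* VII.2.1, VII.3.1, VII.6.2
[SilvermanAEC2009]; A. Agboola, Compositio 143 (2007) §3 [Agboola2007].
-/

noncomputable section

open scoped Classical NNReal

set_option linter.dupNamespace false
set_option autoImplicit false

open NumberField IsDedekindDomain Field
open Literature.NumberTheory.EllipticCurves Literature.NumberTheory.EllipticCurves.GreenbergSelmer
open Literature.NumberTheory.EllipticCurves.Castella2018.AcSelmer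
open Literature.NumberTheory.EllipticCurves.Agboola2007
open Literature.NumberTheory.EllipticCurves.ResKernel
open Literature.NumberTheory.EllipticCurves.Greenberg1999 Literature.NumberTheory.EllipticCurves.CocycleCriteria
open Literature.NumberTheory.GaloisRepresentations

universe u

namespace Summit.BirchSwinnertonDyer.BirchSwinnertonDyer.Theorems.PrintCf2.RestrictedSelmerPair

/-! ## §1. `E(K_v) ⊗ ℚ_p/ℤ_p = 0` for `v ∤ p` (Greenberg Prop. 2.1 at the base) -/

section LocalDivisible

variable {K : Type u} [Field K] [NumberField K] (W : WeierstrassCurve K) [W.IsElliptic] (p : ℕ) [Fact p.Prime]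

set_option maxHeartbeats 1600000 in
/-- **`E(K_v) ⊗ ℚ_p/ℤ_p = 0` for `v ∤ p`**: every `Γ_{K_v}`-fixed point `y` of `E(K̄_v)` is `p • y′` for a `Γ_{K_v}`-fixed `y′` up to a
`p`-power torsion point (fixed as well). Proof = the tree's `Greenberg1999.exists_sub_smul_mem_primaryComponent_fixedPoints_localSubgroup`
(the same statement for the points over the local `ℤ_p`-tower) with `H_∞` replaced by `Γ_{K_v}`: on the minimal model `m • y ∈ E₁`
(`m = p^a b`, `p ∤ b`; Kodaira–Néron over `K_v^{nr}`), `m • y = p^{a+1} • u` with `u ∈ E₁(K_v)` (`[p]` is invertible on `E₁` and the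
root is as rational as the point), Bézout. (adapted from Literature/NumberTheory/EllipticCurves/Greenberg1999/LocalTowerKummerVanishingProofs.lean)
[cite: GreenbergLNM1716, §2 Prop. 2.1 (p. 72); §3 Lemma 3.3 (proof, p. 87)] [cite: SilvermanAEC2009, Prop. VII.2.1, Prop. VII.3.1, Cor. VII.6.2] -/
theorem exists_sub_smul_mem_primaryComponent_fixedPoints_top
    (v : HeightOneSpectrum (𝓞 K)) (hpv : ((p : ℕ) : 𝓞 K) ∉ v.asIdeal) :
    ∀ y : FixedPoints.addSubgroup (⊤ : Subgroup (absoluteGaloisGroup (v.adicCompletion K))) (localPoints W (v.adicCompletion K)),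
      ∃ y' : FixedPoints.addSubgroup (⊤ : Subgroup (absoluteGaloisGroup (v.adicCompletion K))) (localPoints W (v.adicCompletion K)),
        y - p • y' ∈ AddCommGroup.primaryComponent
          (FixedPoints.addSubgroup (⊤ : Subgroup (absoluteGaloisGroup (v.adicCompletion K))) (localPoints W (v.adicCompletion K))) p := by
  -- notation
  let G : Type u := Field.absoluteGaloisGroup (v.adicCompletion K)
  let Pt : Type u := localPoints W (v.adicCompletion K)
  let Hi : Subgroup G := ⊤
  -- the spectral valuation, the prime `𝔐`, `p ∈ 𝓞_vˣ`, inertia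
  obtain ⟨w, hw⟩ := v.exists_spectralValuation
  obtain ⟨𝔐, h𝔐⟩ := v.localPrimesAbove_nonempty
  have hp : IsUnit ((p : ℕ) : (v.adicCompletionIntegers K)) := by
    have h := IsDedekindDomain.HeightOneSpectrum.isUnit_algebraMap_adicCompletionIntegers K v hpv
    rwa [map_natCast] at h
  have hI : ∀ σ ∈ 𝔐.inertia G, σ ∈ Hi := fun σ _ ↦ Subgroup.mem_top σ
  -- the equivariant transport `E(K̄_v) ≃ V(K̄_v)` to the minimal model (as for Milne, ADT I.3.8)
  obtain ⟨C, hC⟩ := W.exists_variableChange_eq_localMinimalIntegralModel v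
  haveI := WeierstrassCurve.isIntegral_spectralValuation_baseChange hw (W.localMinimalIntegralModel v)
  have hC' := congrArg (fun X : WeierstrassCurve (v.adicCompletion K) ↦ X.baseChange (AlgebraicClosure (v.adicCompletion K))) hC
  let Φ : Pt ≃+ (((W.localMinimalIntegralModel v).map (algebraMap (v.adicCompletionIntegers K) (v.adicCompletion K))).baseChange (AlgebraicClosure (v.adicCompletion K))).toAffine.Point :=
    ((WeierstrassCurve.Affine.Point.congrEquiv
        (WeierstrassCurve.baseChange_baseChange_adicCompletion W v).symm).trans
      (WeierstrassCurve.VariableChange.pointEquivBaseChange (W.baseChange (v.adicCompletion K)) C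
        (AlgebraicClosure (v.adicCompletion K)))).trans
      (WeierstrassCurve.Affine.Point.congrEquiv hC')
  have hΦ : ∀ (σ : G) (Q : Pt), Φ (σ • Q) = WeierstrassCurve.Affine.Point.map ((absoluteGaloisGroup.toAlgEquiv (v.adicCompletion K) σ : AlgebraicClosure (v.adicCompletion K) ≃ₐ[v.adicCompletion K] AlgebraicClosure (v.adicCompletion K)) : AlgebraicClosure (v.adicCompletion K) →ₐ[v.adicCompletion K] AlgebraicClosure (v.adicCompletion K)) (Φ Q) := by
    intro σ Q
    change WeierstrassCurve.Affine.Point.congrEquiv hC'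
        (WeierstrassCurve.VariableChange.pointEquivBaseChange (W.baseChange (v.adicCompletion K)) C (AlgebraicClosure (v.adicCompletion K))
        (WeierstrassCurve.Affine.Point.congrEquiv (WeierstrassCurve.baseChange_baseChange_adicCompletion W v).symm (σ • Q))) =
      WeierstrassCurve.Affine.Point.map _ (WeierstrassCurve.Affine.Point.congrEquiv hC'
        (WeierstrassCurve.VariableChange.pointEquivBaseChange (W.baseChange (v.adicCompletion K)) C (AlgebraicClosure (v.adicCompletion K))
          (WeierstrassCurve.Affine.Point.congrEquiv (WeierstrassCurve.baseChange_baseChange_adicCompletion W v).symm Q)))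
    rw [WeierstrassCurve.congrEquiv_smul, WeierstrassCurve.VariableChange.pointEquivBaseChange_map_algEquiv]
    exact WeierstrassCurve.Affine.Point.congrEquiv_baseChange_map hC _ _
  -- `M = E(K̄_v)^{Γ_{K_v}} = E(K_v)`, `B = M[p^∞]`
  set Mi : AddSubgroup Pt := FixedPoints.addSubgroup Hi Pt with hMi
  set B : AddSubgroup Mi := AddCommGroup.primaryComponent Mi p with hB
  have hMiI : ∀ (m : Mi) (τ : G), τ ∈ 𝔐.inertia G → WeierstrassCurve.Affine.Point.map ((absoluteGaloisGroup.toAlgEquiv (v.adicCompletion K) τ : AlgebraicClosure (v.adicCompletion K) ≃ₐ[v.adicCompletion K] AlgebraicClosure (v.adicCompletion K)) : AlgebraicClosure (v.adicCompletion K) →ₐ[v.adicCompletion K] AlgebraicClosure (v.adicCompletion K)) (Φ m) = Φ m := by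
    intro m τ hτ
    rw [← hΦ]
    exact congrArg Φ (m.2 ⟨τ, hI τ hτ⟩)
  intro y
  obtain ⟨m, hm, hmK⟩ :=
    W.exists_nsmul_mem_kernel_of_forall_inertia hw h𝔐 (P := Φ y) (fun τ hτ ↦ hMiI y τ hτ)
  obtain ⟨a, b, hb, hmab⟩ :=
    Nat.exists_eq_pow_mul_and_not_dvd hm.ne' p (Fact.out : p.Prime).ne_one
  -- `m • Φ y = p^(a+1) • u` with `u ∈ E₁` fixed by `Γ_{K_v}`
  have hmI : ∀ τ ∈ 𝔐.inertia G, WeierstrassCurve.Affine.Point.map ((absoluteGaloisGroup.toAlgEquiv (v.adicCompletion K) τ : AlgebraicClosure (v.adicCompletion K) ≃ₐ[v.adicCompletion K] AlgebraicClosure (v.adicCompletion K)) : AlgebraicClosure (v.adicCompletion K) →ₐ[v.adicCompletion K] AlgebraicClosure (v.adicCompletion K)) (m • Φ y) = m • Φ y :=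
    fun τ hτ ↦ by rw [map_nsmul, hMiI y τ hτ]
  obtain ⟨u, -, hufix, hu⟩ := W.exists_pow_nsmul_eq_of_mem_kernel hw h𝔐 hp (a + 1) hmK hmI
  -- `u` comes from `M`
  have hu' : Φ.symm u ∈ Mi := by
    rintro ⟨h, hh⟩
    show h • Φ.symm u = Φ.symm u
    apply Φ.injective
    rw [hΦ, AddEquiv.apply_symm_apply]
    refine hufix h ?_
    rw [map_nsmul, ← hΦ]
    exact congrArg (fun z ↦ m • Φ z) (y.2 ⟨h, hh⟩)
  set u' : Mi := ⟨Φ.symm u, hu'⟩ with hu'def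
  -- `T₀ = b • y - p • u'` is `p^a`-torsion
  have hT₀ : b • y - p • u' ∈ B := by
    rw [hB, PrimaryCoinvariants.mem_primaryComponent_iff_exists_nsmul]
    refine ⟨a, ?_⟩
    apply Subtype.ext
    apply Φ.injective
    simp only [smul_sub, AddSubgroupClass.coe_nsmul, AddSubgroupClass.coe_sub, map_sub, map_nsmul,
      ZeroMemClass.coe_zero, map_zero, hu'def, AddEquiv.apply_symm_apply]
    rw [← mul_smul, ← mul_smul, ← pow_succ, hu, ← hmab, sub_self]
  -- Bézout
  have hcop : IsCoprime (b : ℤ) (p : ℤ) :=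
    Nat.isCoprime_iff_coprime.mpr ((Nat.Prime.coprime_iff_not_dvd Fact.out).mpr hb).symm
  obtain ⟨α, β, hαβ⟩ := hcop
  refine ⟨α • u' + β • y, ?_⟩
  have e : y - p • (α • u' + β • y) = α • (b • y - p • u') := by
    have h2 : (1 - (α * b + β * p)) • y = 0 := by rw [hαβ, sub_self, zero_smul]
    have h3 : y - p • (α • u' + β • y) - α • (b • y - p • u') = (1 - (α * b + β * p)) • y := by
      module
    rw [← sub_eq_zero, h3, h2]
  rw [e]
  exact B.zsmul_mem hT₀ α

/-- **`p^N` form of `E(K_v) ⊗ ℚ_p/ℤ_p = 0`**: for every `Γ_{K_v}`-fixed `y ∈ E(K̄_v)` and every `N`, `y = p^N • y′ + t` with `y′`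
`Γ_{K_v}`-fixed and `t` a `p`-power torsion point. [cite: GreenbergLNM1716, §2 Prop. 2.1 (p. 72)] -/
theorem exists_sub_pow_smul_fixed (v : HeightOneSpectrum (𝓞 K)) (hpv : ((p : ℕ) : 𝓞 K) ∉ v.asIdeal) (N : ℕ)
    (y : localPoints W (v.adicCompletion K)) (hy : ∀ σ : absoluteGaloisGroup (v.adicCompletion K), σ • y = y) :
    ∃ y' : localPoints W (v.adicCompletion K), (∀ σ : absoluteGaloisGroup (v.adicCompletion K), σ • y' = y') ∧
      ∃ k : ℕ, p ^ k • (y - p ^ N • y') = 0 := by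
  induction N generalizing y with
  | zero => exact ⟨y, hy, 0, by simp⟩
  | succ N ih =>
    obtain ⟨⟨y₁, hy₁⟩, h₁⟩ := exists_sub_smul_mem_primaryComponent_fixedPoints_top W p v hpv ⟨y, fun σ ↦ hy σ⟩
    obtain ⟨k₁, hk₁⟩ := (AddCommGroup.mem_primaryComponent).mp h₁
    obtain ⟨y₂, hy₂, k₂, hk₂⟩ := ih y₁ (fun σ ↦ hy₁ ⟨σ, Subgroup.mem_top σ⟩)
    refine ⟨y₂, hy₂, k₁ + k₂, ?_⟩
    have hk₁' : p ^ k₁ • (y - p • y₁) = 0 := by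
      have := congrArg Subtype.val hk₁
      simpa using this
    have hsplit : y - p ^ (N + 1) • y₂ = (y - p • y₁) + p • (y₁ - p ^ N • y₂) := by
      rw [pow_succ', mul_smul, smul_sub]
      abel
    have h1 : p ^ (k₁ + k₂) • (y - p • y₁) = 0 := by
      rw [pow_add, mul_comm, mul_smul, hk₁', smul_zero]
    have h2 : p ^ (k₁ + k₂) • (p • (y₁ - p ^ N • y₂)) = 0 := by
      rw [smul_comm, pow_add, mul_smul, hk₂, smul_zero, smul_zero]
    rw [hsplit, smul_add, h1, h2, add_zero]

end LocalDivisible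

/-! ## §2. At `v ∤ p` the classical condition is local triviality: `localKerOver p ⊤ K_v = awayKer ⊤ E[p^∞] v` -/

section AwayFromP

variable {K : Type u} [Field K] [NumberField K] (W : WeierstrassCurve K) [W.IsElliptic] (p : ℕ) [Fact p.Prime]
  (v : HeightOneSpectrum (𝓞 K))

/-- **The classical local condition at `v ∤ p` implies local triviality** (Greenberg «`Im κ_v = 0`»): a class of `H¹(⊤, E[p^∞])` dying in
`H¹(Γ_{K_v}, E(K̄_v))` dies in `H¹(⊤ ⊓ D_v, E[p^∞])`. [cite: GreenbergLNM1716, §2 Prop. 2.1 (p. 72) and p. 73 («Im κ_v = 0 if v ∤ p»)]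
[cite: Agboola2007, §3 (arXiv p0008:L8–12, «H¹_f(F_v, W) = 0 if v ∤ 𝔭»)] -/
theorem localKerOver_top_le_awayKer (hpv : ((p : ℕ) : 𝓞 K) ∉ v.asIdeal) :
    W.localKerOver p ⊤ (v.adicCompletion K) ≤ awayKer ⊤ (W.geomPrimaryTorsion p) v := by
  intro c hc
  -- notation
  set E := v.adicCompletion K with hE
  set ι := closureEmb (K := K) (v.adicCompletion K) with hι
  obtain ⟨φ, rfl⟩ := oneCocycleClass_surjective (discreteTopRep (⊤ : Subgroup (absoluteGaloisGroup K)) (W.geomPrimaryTorsion p)) c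
  -- the classical condition: `ι φ(res τ) = τQ - Q` on `Γ_{K_v}`
  have hc' : resH1Hom (resGalSubgroupOfEmb ⊤ ι) ((pointsMapOfEmb W ι).comp (W.geomPrimaryTorsion p).subtype)
      (fun τ P ↦ by
        simp only [AddMonoidHom.coe_comp, AddSubgroup.coe_subtype, Function.comp_apply, Subgroup.smul_def,
          resGalSubgroupOfEmb_apply_coe, Literature.NumberTheory.EllipticCurves.primaryComponent.coe_smul]
        exact pointsMapOfEmb_smul W ι τ P)
      (oneCocycleClass _ φ) = 0 := hc
  rw [resH1Hom_oneCocycleClass_eq_zero_iff] at hc'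
  obtain ⟨Q, hQ⟩ := hc'
  -- finite image: `p^N φ = 0`
  haveI : CompactSpace (absoluteGaloisGroup K) := compactSpace_absoluteGaloisGroup K
  haveI : CompactSpace (⊤ : Subgroup (absoluteGaloisGroup K)) :=
    isCompact_iff_compactSpace.mp (by rw [Subgroup.coe_top]; exact isCompact_univ)
  obtain ⟨N, hN⟩ := exists_pow_smul_apply_eq_zero (p := p) φ.1 (fun g ↦ by
    obtain ⟨k, hk⟩ := (AddCommGroup.mem_primaryComponent).mp (φ.1 g).2
    exact ⟨k, Subtype.ext (by rw [AddSubmonoidClass.coe_nsmul, ZeroMemClass.coe_zero]; exact hk)⟩)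
  -- `y := p^N Q` is `Γ_{K_v}`-rational
  have hy : ∀ σ : absoluteGaloisGroup E, σ • ((p ^ N : ℕ) • Q) = (p ^ N : ℕ) • Q := by
    intro σ
    have h1 := hQ ⟨σ, (mem_localSubgroupOfEmb_iff ⊤ ι σ).mpr (Subgroup.mem_top _)⟩
    have h2 : σ • Q - Q = pointsMapOfEmb W ι ((φ.1 (resGalSubgroupOfEmb ⊤ ι ⟨σ, (mem_localSubgroupOfEmb_iff ⊤ ι σ).mpr
        (Subgroup.mem_top _)⟩) : W.geomPrimaryTorsion p) : W.geomPoints) := h1.symm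
    rw [smul_comm, ← sub_eq_zero, ← smul_sub, h2, ← map_nsmul, ← AddSubmonoidClass.coe_nsmul, hN, ZeroMemClass.coe_zero, map_zero]
  -- §1: `p^N Q = p^N Q₀ + t`, `Q₀` rational, `t` torsion
  obtain ⟨Q₀, hQ₀, k, hk⟩ := exists_sub_pow_smul_fixed W p v hpv N ((p ^ N : ℕ) • Q) hy
  -- `T := Q - Q₀` is torsion of exponent `p^(N+k)`, hence algebraic
  have hT : ((p ^ (N + k) : ℕ) : ℤ) • (Q - Q₀) = 0 := by
    rw [natCast_zsmul, pow_add, mul_comm, mul_smul, smul_sub, ← smul_sub] at *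
    convert hk using 2
    rw [smul_sub]
  have hn : ((p ^ (N + k) : ℕ) : ℤ) ≠ 0 := by exact_mod_cast (pow_pos (Fact.out : p.Prime).pos _).ne'
  set T : AddSubgroup.torsionBy (localPoints W E) ((p ^ (N + k) : ℕ) : ℤ) :=
    ⟨Q - Q₀, by change ((p ^ (N + k) : ℕ) : ℤ) • (Q - Q₀) = 0; exact hT⟩ with hTdef
  set t : W.geomTorsion ((p ^ (N + k) : ℕ) : ℤ) := (W.torsionPointsEquiv ((p ^ (N + k) : ℕ) : ℤ) (E := E) hn).symm T with htdef
  have ht : pointsMap W E (t : W.geomPoints) = Q - Q₀ := by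
    rw [htdef, W.pointsMap_torsionPointsEquiv_symm]
  have htp : (t : W.geomPoints) ∈ W.geomPrimaryTorsion p := by
    refine (AddCommGroup.mem_primaryComponent).mpr ⟨N + k, ?_⟩
    have h2 := t.2
    change ((p ^ (N + k) : ℕ) : ℤ) • (t : W.geomPoints) = 0 at h2
    rw [natCast_zsmul] at h2
    exact h2
  -- the cocycle is the coboundary of `t` on the decomposition group
  change resOfLe (W.geomPrimaryTorsion p) (inf_le_left : ⊤ ⊓ decomp v ≤ ⊤) (oneCocycleClass _ φ) = 0
  rw [resOfLe, resH1Hom_oneCocycleClass_eq_zero_iff]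
  refine ⟨⟨(t : W.geomPoints), htp⟩, fun g ↦ ?_⟩
  obtain ⟨σ, hσ⟩ := (mem_decomp_iff v (g : absoluteGaloisGroup K)).mp (Subgroup.mem_inf.mp g.2).2
  have h1 := hQ ⟨σ, (mem_localSubgroupOfEmb_iff ⊤ ι σ).mpr (Subgroup.mem_top _)⟩
  -- `ι φ(g) = σQ - Q = σ(Q₀ + T) - (Q₀ + T) = σT - T = ι (σ t - t)`
  have hg : (subgroupInclusion (inf_le_left : ⊤ ⊓ decomp v ≤ ⊤) g : (⊤ : Subgroup (absoluteGaloisGroup K))) =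
      resGalSubgroupOfEmb ⊤ ι ⟨σ, (mem_localSubgroupOfEmb_iff ⊤ ι σ).mpr (Subgroup.mem_top _)⟩ := by
    apply Subtype.ext
    rw [resGalSubgroupOfEmb_apply_coe]
    exact hσ.symm
  apply Subtype.ext
  apply pointsMapOfEmb_injective W ι
  change pointsMapOfEmb W ι ((φ.1 (subgroupInclusion (inf_le_left : ⊤ ⊓ decomp v ≤ ⊤) g) : W.geomPrimaryTorsion p) : W.geomPoints) =
    pointsMapOfEmb W ι (((g • (⟨(t : W.geomPoints), htp⟩ : W.geomPrimaryTorsion p) -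
      (⟨(t : W.geomPoints), htp⟩ : W.geomPrimaryTorsion p) : W.geomPrimaryTorsion p) : W.geomPoints))
  rw [hg]
  change ((pointsMapOfEmb W ι).comp (W.geomPrimaryTorsion p).subtype) _ = _ at h1
  rw [AddMonoidHom.comp_apply, AddSubgroup.coe_subtype] at h1
  rw [h1, AddSubgroupClass.coe_sub, map_sub, Literature.NumberTheory.EllipticCurves.primaryComponent.coe_smul, Subgroup.smul_def]
  change _ = pointsMapOfEmb W ι ((g : absoluteGaloisGroup K) • (t : W.geomPoints)) - pointsMapOfEmb W ι (t : W.geomPoints)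
  rw [← hσ]
  change _ = pointsMap W E (resGal (K := K) E σ • (t : W.geomPoints)) - pointsMap W E (t : W.geomPoints)
  rw [pointsMap_smul, ht, smul_sub, hQ₀ σ]
  change (σ : absoluteGaloisGroup E) • Q - Q = _
  abel

/-- **AT `v ∤ p` THE CLASSICAL LOCAL CONDITION IS LOCAL TRIVIALITY**: `localKerOver p ⊤ K_v = awayKer ⊤ E[p^∞] v` (with the tree's converse
`AcSigned.awayKer_le_localKummerOverOfEmb` + `Kobayashi2003.localKummerOverOfEmb_le_localKerOverOfEmb`). This is the sentence by which Agboola's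
restricted Selmer groups (`Agboola2007.restrictedSelmer`, defined with `awayKer` away from `p`) agree with the Kummer-condition groups of the paper.
[cite: GreenbergLNM1716, §2 Prop. 2.1, p. 73] [cite: Agboola2007, §3 (arXiv p0008:L8–12)] -/
theorem localKerOver_top_eq_awayKer (hpv : ((p : ℕ) : 𝓞 K) ∉ v.asIdeal) :
    W.localKerOver p ⊤ (v.adicCompletion K) = awayKer ⊤ (W.geomPrimaryTorsion p) v := by
  apply le_antisymm (localKerOver_top_le_awayKer W p v hpv)
  rw [WeierstrassCurve.localKerOver_eq_ofEmb]
  exact (AcSigned.awayKer_le_localKummerOverOfEmb W p ⊤ v ⊥).trans (Kobayashi2003.localKummerOverOfEmb_le_localKerOverOfEmb ⊥)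

end AwayFromP

/-! ## §3. The CM summand: the canonical Kummer subgroup is locally zero away from `p` -/

section Summand

variable {K : Type u} [Field K] [NumberField K] (V : WeierstrassCurve K) [V.IsElliptic] (p : ℕ) [Fact p.Prime]
  (π : V.endRing) (r r' : ℤ_[p])

/-- **A class of the summand whose image satisfies the classical condition at `w ∤ p` is locally ZERO at `w`**:
`ι_*⁻¹(localKerOver p ⊤ K_w) ≤ ker loc_w` on `H¹(K, E[𝔮^∞])`, for complementary eigen-subgroups (ι_* is injective on `H¹(⊤ ⊓ D_w, ·)`,
p662922 `resH1Hom_subtype_injective`). [cite: GreenbergLNM1716, §2] [cite: Agboola2007, §3] -/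
theorem comap_localKerOver_le_ker_resOfLe_of_not_mem
    (hinf : V.endEigenPrimaryTorsion p π r ⊓ V.endEigenPrimaryTorsion p π r' = ⊥)
    (hsup : V.endEigenPrimaryTorsion p π r ⊔ V.endEigenPrimaryTorsion p π r' = ⊤)
    (w : HeightOneSpectrum (𝓞 K)) (hpw : ((p : ℕ) : 𝓞 K) ∉ w.asIdeal) :
    (V.localKerOver p ⊤ (w.adicCompletion K)).comap
        (resH1Hom (ContinuousMonoidHom.id _) (V.endEigenPrimaryTorsion p π r).subtype (fun _ _ ↦ rfl)) ≤
      (resOfLe ↥(V.endEigenPrimaryTorsion p π r) (inf_le_left : ⊤ ⊓ decomp w ≤ ⊤)).ker := by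
  intro c hc
  rw [AddSubgroup.mem_comap, localKerOver_top_eq_awayKer V p w hpw] at hc
  obtain ⟨e, he₁, -, -, he⟩ := exists_eigenProjector V p π r r' hinf hsup
  rw [AddMonoidHom.mem_ker]
  apply resH1Hom_subtype_injective V p π r (⊤ ⊓ decomp w) e he₁ he
  rw [map_zero, ← resOfLe_resH1Hom_subtype V p π r]
  exact hc

/-- **THE «TRIVIAL AWAY FROM `p`» HALF OF (H1).** For the CM summand `M = E[𝔮^∞]` with complementary conjugate summand, the canonical Kummer
subgroup `Q_M = ι_*⁻¹(res_⊤(range κ))` of p663238 is locally zero at every finite `w ∤ p`: `Q_M ≤ ker loc_w` — Agboola's away-from-`p`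
condition of `𝔖_𝔮(K, M)` holds for the Kummer classes of the summand. [cite: Agboola2007, §3 (arXiv p0008:L8–12, L58–64)]
[cite: GreenbergLNM1716, §2 Prop. 2.1] -/
theorem comap_kummer_le_ker_resOfLe_of_not_mem
    (hinf : V.endEigenPrimaryTorsion p π r ⊓ V.endEigenPrimaryTorsion p π r' = ⊥)
    (hsup : V.endEigenPrimaryTorsion p π r ⊔ V.endEigenPrimaryTorsion p π r' = ⊤)
    (w : HeightOneSpectrum (𝓞 K)) (hpw : ((p : ℕ) : 𝓞 K) ∉ w.asIdeal) :
    (((V.kummerMapPInfty p V.zsmul_geomPoints_surjective_holds).range).map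
          (resSubgroup ⊤ (V.geomPrimaryTorsion p))).comap
        (resH1Hom (ContinuousMonoidHom.id _) (V.endEigenPrimaryTorsion p π r).subtype (fun _ _ ↦ rfl)) ≤
      (resOfLe ↥(V.endEigenPrimaryTorsion p π r) (inf_le_left : ⊤ ⊓ decomp w ≤ ⊤)).ker :=
  (comap_kummer_le_comap_localKerOver V p π r w).trans (comap_localKerOver_le_ker_resOfLe_of_not_mem V p π r r' hinf hsup w hpw)

end Summand

end Summit.BirchSwinnertonDyer.BirchSwinnertonDyer.Theorems.PrintCf2.RestrictedSelmerPair

end
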